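import Summits.QuantumFields.YangMills.Theorems.BalabanUVNodesK1AxV11Defs
import Summits.QuantumFields.YangMills.Theorems.BalabanUVNodesK1AxBetaContKernel

/-!
# K1ᴬ (stmt-QuantumFields-27239 `StabilityBRunRowsAtRecordR13SepCoPHVAx`, LINE 2′ v11.1) — THE `stub_cont13(VW)` DOORS FROM THE THREE PRIMITIVE β-KERNEL LETTERS
# (loc-uniform volume limit · (5.10) decay of the limit kernel on the box · history-continuity of the finite-volume kernels), over PTB-1's generic kernel

Cell `pub-ymgap` (YM-PLAN Track A, D-0062), seat `pub-ymgap-dag-n24-c` (g25; the `-a` knit-by-name hand of LINE 2′).  `--kind proof --supports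
stmt-QuantumFields-27239 --as helper`; COUNT-NEUTRAL; theorems only (0 `def`, 0 `sorry`, 0 `instance`, 0 `notation`; standard axioms).  CUT EDITION per dag-lead
WORDS 743 (DEDUP FLAG, 2026-08-31T10:50Z): the generic kernel and its Stage-8 ∕ Stage-13 `SurvCont` faces LANDED 86 s before this seat's INTENT-1 as ★ PTB-1 g6's
✓p820605 `…K1AxBetaContKernel` (`continuousOn_plimOf_entry`, `betaContH_secondMoment_plimOf`, `betaContH_of_eq_secondMoment_plimOf`, `survCont_of_eq_secondMoment_plimOf`,
`betaContH_betaOfRecord₈Tχ_of_kernelLetters`, `survCont_betaOfRecord₁₃Ax_of_kernelLetters`) — IMPORTED AND USED BY NAME here, nothing of it re-proved; this file adds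
only what WORDS 743 (1) found NOT in the tree: two small generic glue lemmas, the Stage-13 `BetaContH` face by name, and the three K1ᴬ DOORS.

WHAT THIS FILE IS.  ◆ CRIT-1 g37's door plan O.5147 (relayed by dag-lead WORDS 740 (2)) for the DECIDING item's third stub, finished BY NAME.  The registered stub
`stub_cont13VW : ∀ F, RunRowsAtSomeRecord13PWSVW F → RunRowsContAtSomeRecord13PWSVW F` (`…K1AxV11Defs` :238; LINE 1 twin `stub_cont13` :313) adds to the run rows the
survivor-continuity conjunct (C) `SurvCont (Node00.betaOfRecord₁₃Ax F 2 θ.toStage13Params) γ₀` of the RE-CENTRED β of record, which ON THE BOX `]0, θ.γ]^{k+1}` IS the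
(1.22)-moment `Σ_z Π_{k+1}(v; z)₀₁ z₀ z₁` of the `limUnder`-valued (1.21) kernel `plimOf F (mergedTermFamilyMatT F N (TβOfRecord₁₃ F N) (chiβOfRecord₁₃Ax F N θ) θ.εbg)
θ.ρ8 θ.bV k v`.  Continuity in the history is NOT by construction; the three PRIMITIVE letters that pay it (◆'s names — ★★ DEF-1 types the `def`s; NONE is declared
here, each is a HYPOTHESIS spelled out in the body a definition would carry, so DEF-1's letters feed these theorems by `Iff.rfl`):
* (T-β1) `PolLimitLocUnifOnBoxOf` — for every scale `k` and site `z` the windowed finite-volume kernels `v ↦ pvolOf F fam ρ bV k v K 0 1 z` converge, as `K → ∞`,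
  LOCALLY UNIFORMLY in the history `v` on the box to `v ↦ plimOf F fam ρ bV k v 0 1 z` ([I] (1.21) p.264 «This limit exists by the localized representation (1.7)» —
  existence only is printed; local uniformity in the suppressed history is the located unprinted input; cf. ★ P3's rate-free record letter
  `K0AxMomentRoad.RecordPvolLocUniformCauchyOnBoxAx`);
* (T-β2) `PlimDecayOnBoxOf F fam ρ bV γ C δ₁` (EXISTS, `…K0RecordFormatNamesDecay` :64) — (5.10) p.293 for the `(0,1)`-component of the limit kernel, ONE `(C, δ₁)` on the box;
* (T-β3) `PvolHistContOnBoxOf` — `∀ k K z, ContinuousOn (v ↦ pvolOf F fam ρ bV k v K 0 1 z) (Box γ k)` ((1.20) p.264 at finite volume: a derivative at zero of the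
  logarithm of a finite-dimensional integral; cf. `K0AxMomentRoad.RecordPvolContOnBoxAx` and director-ym №559's pointer `continuousOn_polWindow_of_hessCont`).

WHAT IS PROVED (kernel-checked bookkeeping; every analytic input a hypothesis):
* §1 GENERIC glue over `(fam, ρ, bV)` (not in ✓p820605): `plimOf_eq_of_tendstoLocallyUniformlyOn` (`plimOf` IS any locally-uniform volume limit on the parameter
  set, `Node00.polLimit_eq_of_tendsto`), `tendstoLocallyUniformlyOn_plimOf_of_limit` (so an ANONYMOUS-limit letter `∃ g, TendstoLocallyUniformlyOn … g …` is the
  NAMED-limit letter (T-β1), `TendstoLocallyUniformlyOn.congr_right`), and a PRIVATE `plimDecayOnBoxOf_mono` ((T-β2) restricts to smaller boxes; the citable generic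
  home is ★★ DEF-1's K0-names leaf ED.25, dag-lead WORDS 745).
* §2 THE STAGE-13 `BetaContH` FACE BY NAME: ★★ `betaContH_betaOfRecord₁₃Ax_of_kernelLetters` — at ANY re-centred tuple `θ : Stage13Params F N`, the three letters for the
  record's merged family on a box `γ ≤ θ.γ` ⟹ `BetaContH γ₀ (betaOfRecord₁₃Ax F N θ)` for `γ₀ ≤ γ` (= PTB-1's Stage-8 parent `betaContH_betaOfRecord₈Tχ_of_kernelLetters` read
  through the `abbrev` `Record13Ax.betaOfRecord₁₃Ax`; the `SurvCont` form is PTB-1's `survCont_betaOfRecord₁₃Ax_of_kernelLetters`, used below, not restated).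
* §3 THE K1ᴬ DOORS (NEW): ★★★ `cont13All_of_kernelLetters` — the three letters at EVERY admissible Stage-13 tuple with the re-centred provisos (N = 2), on its own box
  `θ.γ` ⟹ the ∀θ supplier letter `K1AxV11Defs.Cont13All`; hence ★★★ `stubCont13VW_of_kernelLetters` — THE REGISTERED TEXT of `stub_cont13VW` (LINE 2′; =
  `K1AxV11StubTexts.Stub3TextVW` unfolded) — and `stubCont13_of_kernelLetters` (LINE 1's `stub_cont13`), by `K1AxV11Defs.stubCont13VW_of_cont13All` ∕
  `stubCont13_of_cont13All` (at a rows witness read (C) at the presenting tuple of `RecordS(ⱽ)`, level `min γ₀ w.γ`).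

HONEST FRAMING (binding).  CONDITIONAL helpers: the three letters are HYPOTHESES — [I] §1 pp.263–264 asserts smoothness of the effective-action coefficients in the
couplings WITHOUT proof, (1.21) p.264 asserts the volume limit WITHOUT rate or uniformity, (5.10) p.293 is print's §5 input; none is asserted, ported or discharged here.
`stub_cont13VW` ∕ `stub_cont13` stay OPEN (a stub closes only on a hypothesis-free proof); K1ᴬ stmt-QuantumFields-27239 OPEN (v11.1 stubs 0∕6); K0ᴬ ∕ K3ᴬ OPEN; COUNT
8∕27 (A 8∕28) · K 1∕4 UNMOVED; R4 = the conditional finite-𝕋⁴ rung `BalabanLadder.UV` at fixed `ε = L^(−K)` only — NOT continuum ∕ ℝ⁴ ∕ OS; the Yang–Mills mass gap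
(Clay) is NOT proved by any of this.
-/

noncomputable section

open Filter Topology
open scoped BigOperators Matrix.Norms.L2Operator

namespace Summit.QuantumFields.YangMills.Theorems.K1AxStubCont13DoorOfKernelLetters

open Literature.MathematicalPhysics.QuantumFieldTheory.Balaban1983to89
open Literature.MathematicalPhysics.QuantumFieldTheory.Balaban1983to89.Node00
open Literature.MathematicalPhysics.QuantumFieldTheory.Balaban1983to89.T4Continuum (T4Family)
open Literature.MathematicalPhysics.QuantumFieldTheory.Balaban1983to89.FlowStep
open Summit.QuantumFields.YangMills.Theorems.K0RecordFormatNames (pvolOf plimOf PlimDecayOnBoxOf)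
open Summit.QuantumFields.YangMills.Theorems.BalabanUVNodesK2NamedJetsRunRemAt (SurvCont)
open Summit.QuantumFields.YangMills.Theorems.K1AxBetaContKernel (betaContH_betaOfRecord₈Tχ_of_kernelLetters survCont_betaOfRecord₁₃Ax_of_kernelLetters)
open Summit.QuantumFields.YangMills.Theorems.K1AxV11Defs (Cont13All RunRowsAtSomeRecord13PWSVW RunRowsContAtSomeRecord13PWSVW
  RunRowsAtSomeRecord13PWS RunRowsContAtSomeRecord13PWS stubCont13VW_of_cont13All stubCont13_of_cont13All)

/-! ## §1  GENERIC glue over a term family (the pieces WORDS 743 (1) found absent): named vs anonymous limit; (T-β2) on smaller boxes -/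

section Generic

variable (F : T4Family)
variable {𝔄 : Type*} [NormedRing 𝔄] [NormedAlgebra ℝ 𝔄]
variable {V : Type*} [NormedAddCommGroup V] [NormedSpace ℝ V] {ι : Type*} [Fintype ι]
variable (fam : TermFamily1 F 𝔄) (ρ : V →L[ℝ] 𝔄) (bV : Module.Basis ι ℝ V)

/-- Under a locally uniform volume limit `g` of the windowed kernel entry on a parameter set `s` of histories, `plimOf` IS `g` on `s` (limits in `ℝ` are unique;
`Node00.polLimit_eq_of_tendsto` + `TendstoLocallyUniformlyOn.tendsto_at`). [cite: Balaban1987RG1, (1.21) p.264] -/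
theorem plimOf_eq_of_tendstoLocallyUniformlyOn {k : ℕ} {s : Set (Fin (k + 1) → ℝ)} {μ ν : Fin 4} {z : Fin 4 → ℤ} {g : (Fin (k + 1) → ℝ) → ℝ}
    (hU : TendstoLocallyUniformlyOn (fun (K : ℕ) (v : Fin (k + 1) → ℝ) => pvolOf F fam ρ bV k v K μ ν z) g atTop s)
    {v : Fin (k + 1) → ℝ} (hv : v ∈ s) : plimOf F fam ρ bV k v μ ν z = g v :=
  polLimit_eq_of_tendsto F (k + 1) (fun K => fam k v K) ρ bV (hU.tendsto_at hv)

/-- Hence an ANONYMOUS-limit letter is the NAMED-limit letter (T-β1): locally uniform convergence to some `g` on `s` is locally uniform convergence to `plimOf` on `s`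
(`TendstoLocallyUniformlyOn.congr_right`). [cite: Balaban1987RG1, (1.21) p.264] -/
theorem tendstoLocallyUniformlyOn_plimOf_of_limit {k : ℕ} {s : Set (Fin (k + 1) → ℝ)} {μ ν : Fin 4} {z : Fin 4 → ℤ} {g : (Fin (k + 1) → ℝ) → ℝ}
    (hU : TendstoLocallyUniformlyOn (fun (K : ℕ) (v : Fin (k + 1) → ℝ) => pvolOf F fam ρ bV k v K μ ν z) g atTop s) :
    TendstoLocallyUniformlyOn (fun (K : ℕ) (v : Fin (k + 1) → ℝ) => pvolOf F fam ρ bV k v K μ ν z)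
      (fun v : Fin (k + 1) → ℝ => plimOf F fam ρ bV k v μ ν z) atTop s :=
  hU.congr_right fun _ hv => (plimOf_eq_of_tendstoLocallyUniformlyOn F fam ρ bV hU hv).symm

omit [NormedRing 𝔄] [NormedAlgebra ℝ 𝔄] [NormedAddCommGroup V] [NormedSpace ℝ V] [Fintype ι] in
/-- (T-β2) restricts to every smaller box (`FlowStep.box_mono`).  PRIVATE (dag-lead WORDS 745): the citable generic home of this monotonicity is ★★ DEF-1's
K0-names leaf (ED.25); this copy only serves the doors below. [cite: Balaban1987RG1, (5.10) p.293] -/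
private theorem plimDecayOnBoxOf_mono [NormedRing 𝔄] [NormedAlgebra ℝ 𝔄] [NormedAddCommGroup V] [NormedSpace ℝ V] [Fintype ι]
    (fam : TermFamily1 F 𝔄) (ρ : V →L[ℝ] 𝔄) (bV : Module.Basis ι ℝ V) {γ γ₀ C δ₁ : ℝ} (hle : γ₀ ≤ γ)
    (h2 : PlimDecayOnBoxOf F fam ρ bV γ C δ₁) : PlimDecayOnBoxOf F fam ρ bV γ₀ C δ₁ :=
  ⟨h2.1, fun k v hv => h2.2 k v (box_mono hle k hv)⟩

end Generic

/-! ## §2  THE STAGE-13 `BetaContH` FACE at ANY re-centred tuple `θ` (PTB-1's Stage-8 parent read through the `abbrev` `betaOfRecord₁₃Ax`) -/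

section AtTheta

variable (F : T4Family) (N : ℕ) [NeZero N] (θ : Stage13Params F N)

/-- ★★ **(C) `BetaContH γ₀ (betaOfRecord₁₃Ax F N θ)` FROM THE THREE PRIMITIVE LETTERS on a box `γ ≤ θ.γ`, every `γ₀ ≤ γ`, θ-GENERIC** ((T-β1) loc-unif volume limit of
the windowed kernels of the re-centred merged term of record, (T-β2) `PlimDecayOnBoxOf … γ C δ₁`, (T-β3) history-continuity of every finite-volume kernel entry on the box):
`K1AxBetaContKernel.betaContH_betaOfRecord₈Tχ_of_kernelLetters` at `(TβOfRecord₁₃ F N, chiβOfRecord₁₃Ax F N θ, θ.toStage8Params)` BY NAME — `betaOfRecord₁₃Ax F N θ` IS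
def-B's β there (`Record13Ax.betaOfRecord₁₃Ax`, an `abbrev`).  CONDITIONAL; nothing asserted. [cite: Balaban1987RG1, §1 pp.263–264, (1.20)–(1.22) p.264, (2.9) p.266, (5.10) p.293] -/
theorem betaContH_betaOfRecord₁₃Ax_of_kernelLetters {γ γ₀ C δ₁ : ℝ} (hle : γ₀ ≤ γ) (hγ : γ ≤ θ.γ)
    (h1 : letI := θ.instVβ₁; letI := θ.instVβ₂; letI := θ.instιβ
      ∀ (k : ℕ) (z : Fin 4 → ℤ), TendstoLocallyUniformlyOn
        (fun (K : ℕ) (v : Fin (k + 1) → ℝ) => pvolOf F (mergedTermFamilyMatT F N (TβOfRecord₁₃ F N) (chiβOfRecord₁₃Ax F N θ) θ.εbg) θ.ρ8 θ.bV k v K 0 1 z)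
        (fun v : Fin (k + 1) → ℝ => plimOf F (mergedTermFamilyMatT F N (TβOfRecord₁₃ F N) (chiβOfRecord₁₃Ax F N θ) θ.εbg) θ.ρ8 θ.bV k v 0 1 z)
        atTop (Box γ k))
    (h2 : letI := θ.instVβ₁; letI := θ.instVβ₂; letI := θ.instιβ
      PlimDecayOnBoxOf F (mergedTermFamilyMatT F N (TβOfRecord₁₃ F N) (chiβOfRecord₁₃Ax F N θ) θ.εbg) θ.ρ8 θ.bV γ C δ₁)
    (h3 : letI := θ.instVβ₁; letI := θ.instVβ₂; letI := θ.instιβ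
      ∀ (k K : ℕ) (z : Fin 4 → ℤ), ContinuousOn (fun v : Fin (k + 1) → ℝ =>
        pvolOf F (mergedTermFamilyMatT F N (TβOfRecord₁₃ F N) (chiβOfRecord₁₃Ax F N θ) θ.εbg) θ.ρ8 θ.bV k v K 0 1 z) (Box γ k)) :
    BetaContH γ₀ (betaOfRecord₁₃Ax F N θ) :=
  betaContH_betaOfRecord₈Tχ_of_kernelLetters (TβOfRecord₁₃ F N) (chiβOfRecord₁₃Ax F N θ) θ.toStage8Params hle hγ h1 h2 h3

end AtTheta

/-! ## §3  THE K1ᴬ DOORS: the three letters at every admissible tuple ⟹ `Cont13All` ⟹ the REGISTERED texts of `stub_cont13VW` (LINE 2′) and `stub_cont13` (LINE 1) -/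

section Doors

/-- ★★★ **THE ∀θ SUPPLIER LETTER `Cont13All` FROM THE THREE PRIMITIVE β-KERNEL LETTERS**: if at EVERY Stage-13 tuple `θ` (N = 2) carrying the re-centred provisos
and admissible, the windowed finite-volume kernels of the re-centred merged term of record (i) converge locally uniformly in the history on the box `]0, θ.γ]^{k+1}`
to the limit kernel, every scale and site ((T-β1)), (ii) the limit kernel obeys (5.10) on that box with ONE `(C, δ₁)` ((T-β2) `PlimDecayOnBoxOf`), and (iii) every
finite-volume kernel entry is continuous in the history on that box ((T-β3)), then `K1AxV11Defs.Cont13All` (run-wise survivor continuity of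
`betaOfRecord₁₃Ax F 2 θ.toStage13Params` at every level `0 < γ₀ ≤ θ.γ`) — PTB-1's `K1AxBetaContKernel.survCont_betaOfRecord₁₃Ax_of_kernelLetters` BY NAME at `γ := θ.γ`.
CONDITIONAL; nothing asserted. [cite: Balaban1987RG1, §1 pp.263–264, (1.20)–(1.22) p.264, (2.9) p.266, (5.10) p.293] -/
theorem cont13All_of_kernelLetters
    (H : ∀ (F : T4Family) (θ : Node00.Stage13HParams F 2), θ.Provisos₁₃SepCoPHAx F 2 → θ.Admissible F 2 →
      letI := θ.instVβ₁; letI := θ.instVβ₂; letI := θ.instιβ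
      (∀ (k : ℕ) (z : Fin 4 → ℤ), TendstoLocallyUniformlyOn
          (fun (K : ℕ) (v : Fin (k + 1) → ℝ) =>
            pvolOf F (mergedTermFamilyMatT F 2 (TβOfRecord₁₃ F 2) (chiβOfRecord₁₃Ax F 2 θ.toStage13Params) θ.εbg) θ.ρ8 θ.bV k v K 0 1 z)
          (fun v : Fin (k + 1) → ℝ =>
            plimOf F (mergedTermFamilyMatT F 2 (TβOfRecord₁₃ F 2) (chiβOfRecord₁₃Ax F 2 θ.toStage13Params) θ.εbg) θ.ρ8 θ.bV k v 0 1 z)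
          atTop (Box θ.γ k)) ∧
      (∃ C δ₁ : ℝ, PlimDecayOnBoxOf F (mergedTermFamilyMatT F 2 (TβOfRecord₁₃ F 2) (chiβOfRecord₁₃Ax F 2 θ.toStage13Params) θ.εbg) θ.ρ8 θ.bV θ.γ C δ₁) ∧
      (∀ (k K : ℕ) (z : Fin 4 → ℤ), ContinuousOn (fun v : Fin (k + 1) → ℝ =>
          pvolOf F (mergedTermFamilyMatT F 2 (TβOfRecord₁₃ F 2) (chiβOfRecord₁₃Ax F 2 θ.toStage13Params) θ.εbg) θ.ρ8 θ.bV k v K 0 1 z) (Box θ.γ k))) :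
    Cont13All := by
  intro F θ hP hA γ₀ hγ₀ hle
  letI := θ.instVβ₁; letI := θ.instVβ₂; letI := θ.instιβ
  obtain ⟨h1, ⟨C, δ₁, h2⟩, h3⟩ := H F θ hP hA
  exact survCont_betaOfRecord₁₃Ax_of_kernelLetters θ.toStage13Params hγ₀ hle le_rfl h1 h2 h3

/-- ★★★ **THE REGISTERED TEXT OF `stub_cont13VW` (LINE 2′; = `K1AxV11StubTexts.Stub3TextVW` unfolded) FROM THE THREE PRIMITIVE LETTERS at every admissible tuple**
(`K1AxV11Defs.stubCont13VW_of_cont13All` BY NAME: at a rows witness read (C) at the presenting tuple of `RecordSⱽ`, level `min γ₀ w.γ`).  CONDITIONAL — the stub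
itself stays OPEN until the letters are proved. [cite: Balaban1987RG1, §1 pp.263–264, Thm 3 p.264, (1.20)–(1.22) p.264, (5.10) p.293] -/
theorem stubCont13VW_of_kernelLetters
    (H : ∀ (F : T4Family) (θ : Node00.Stage13HParams F 2), θ.Provisos₁₃SepCoPHAx F 2 → θ.Admissible F 2 →
      letI := θ.instVβ₁; letI := θ.instVβ₂; letI := θ.instιβ
      (∀ (k : ℕ) (z : Fin 4 → ℤ), TendstoLocallyUniformlyOn
          (fun (K : ℕ) (v : Fin (k + 1) → ℝ) =>
            pvolOf F (mergedTermFamilyMatT F 2 (TβOfRecord₁₃ F 2) (chiβOfRecord₁₃Ax F 2 θ.toStage13Params) θ.εbg) θ.ρ8 θ.bV k v K 0 1 z)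
          (fun v : Fin (k + 1) → ℝ =>
            plimOf F (mergedTermFamilyMatT F 2 (TβOfRecord₁₃ F 2) (chiβOfRecord₁₃Ax F 2 θ.toStage13Params) θ.εbg) θ.ρ8 θ.bV k v 0 1 z)
          atTop (Box θ.γ k)) ∧
      (∃ C δ₁ : ℝ, PlimDecayOnBoxOf F (mergedTermFamilyMatT F 2 (TβOfRecord₁₃ F 2) (chiβOfRecord₁₃Ax F 2 θ.toStage13Params) θ.εbg) θ.ρ8 θ.bV θ.γ C δ₁) ∧
      (∀ (k K : ℕ) (z : Fin 4 → ℤ), ContinuousOn (fun v : Fin (k + 1) → ℝ =>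
          pvolOf F (mergedTermFamilyMatT F 2 (TβOfRecord₁₃ F 2) (chiβOfRecord₁₃Ax F 2 θ.toStage13Params) θ.εbg) θ.ρ8 θ.bV k v K 0 1 z) (Box θ.γ k))) :
    ∀ F : T4Family, RunRowsAtSomeRecord13PWSVW F → RunRowsContAtSomeRecord13PWSVW F :=
  stubCont13VW_of_cont13All (cont13All_of_kernelLetters H)

/-- **… and THE REGISTERED TEXT OF LINE 1's `stub_cont13`** (`K1AxV11Defs.stubCont13_of_cont13All` BY NAME).  CONDITIONAL.
[cite: Balaban1987RG1, §1 pp.263–264, Thm 3 p.264, (1.20)–(1.22) p.264, (5.10) p.293] -/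
theorem stubCont13_of_kernelLetters
    (H : ∀ (F : T4Family) (θ : Node00.Stage13HParams F 2), θ.Provisos₁₃SepCoPHAx F 2 → θ.Admissible F 2 →
      letI := θ.instVβ₁; letI := θ.instVβ₂; letI := θ.instιβ
      (∀ (k : ℕ) (z : Fin 4 → ℤ), TendstoLocallyUniformlyOn
          (fun (K : ℕ) (v : Fin (k + 1) → ℝ) =>
            pvolOf F (mergedTermFamilyMatT F 2 (TβOfRecord₁₃ F 2) (chiβOfRecord₁₃Ax F 2 θ.toStage13Params) θ.εbg) θ.ρ8 θ.bV k v K 0 1 z)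
          (fun v : Fin (k + 1) → ℝ =>
            plimOf F (mergedTermFamilyMatT F 2 (TβOfRecord₁₃ F 2) (chiβOfRecord₁₃Ax F 2 θ.toStage13Params) θ.εbg) θ.ρ8 θ.bV k v 0 1 z)
          atTop (Box θ.γ k)) ∧
      (∃ C δ₁ : ℝ, PlimDecayOnBoxOf F (mergedTermFamilyMatT F 2 (TβOfRecord₁₃ F 2) (chiβOfRecord₁₃Ax F 2 θ.toStage13Params) θ.εbg) θ.ρ8 θ.bV θ.γ C δ₁) ∧
      (∀ (k K : ℕ) (z : Fin 4 → ℤ), ContinuousOn (fun v : Fin (k + 1) → ℝ =>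
          pvolOf F (mergedTermFamilyMatT F 2 (TβOfRecord₁₃ F 2) (chiβOfRecord₁₃Ax F 2 θ.toStage13Params) θ.εbg) θ.ρ8 θ.bV k v K 0 1 z) (Box θ.γ k))) :
    ∀ F : T4Family, RunRowsAtSomeRecord13PWS F → RunRowsContAtSomeRecord13PWS F :=
  stubCont13_of_cont13All (cont13All_of_kernelLetters H)

end Doors

end Summit.QuantumFields.YangMills.Theorems.K1AxStubCont13DoorOfKernelLetters

end
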